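import Mathlib
import Summits.Ventures.PercRepro2.SwGlueAll

/-!
# The block reduction of row (SW) (blind cell PercRepro2, night-4 g4, 2026-08-24; NIGHT4-SIDE.md §5′)

`sw_all_of_noCut`: if row (SW) holds on every finite multigraph WITHOUT a cut vertex, it holds on
every finite multigraph (`LocRows.Sw_all`).  A cut vertex `c` of `ends : E → Sym2 V` (`HasCut`) splits
the edges into the two sides `E₁ = {e ∣ ends e ⊆ V₁}`, `E₂ = {e ∣ ¬ …}`; `E ≃ E₁ ⊕ E₂`
(`Equiv.sumCompl`), row (SW) is invariant under relabelling the edges (`sw_of_equiv`), and on the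
glued graph it follows from the two sides (`Glue.sw_glue_of_sides`), which have fewer edges —
strong induction on `Fintype.card E`.
-/

namespace Summit.Ventures.PercRepro2

namespace Glue

open Hull LocRows

open scoped Classical

variable {V : Type*}

/-! ## Relabelling the edges -/

section Equiv

variable {E E' : Type*} (ends : E → Sym2 V) (e : E' ≃ E)

/-- Clusters are invariant under relabelling the edges. -/
lemma cluster_comp_equiv (ζ : Config E) (v : V) :
    cluster ends ζ v = cluster (ends ∘ e) (ζ ∘ e) v := by
  ext u
  simp only [mem_cluster]
  constructor
  · intro h
    refine mem_of_conn_of_closed (ends := ends) (ω := ζ) ?_ (mem_cluster_self _ _ _) h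
    intro x hx y hxy
    refine mem_cluster_of_adj hx ?_
    obtain ⟨hne, f, hf, hends⟩ := openGraph_adj.1 hxy
    exact openGraph_adj.2 ⟨hne, e.symm f, by simp [hf], by simp [hends]⟩
  · intro h
    refine mem_of_conn_of_closed (ends := ends ∘ e) (ω := ζ ∘ e) ?_ (mem_cluster_self _ _ _) h
    intro x hx y hxy
    refine mem_cluster_of_adj hx ?_
    obtain ⟨hne, f, hf, hends⟩ := openGraph_adj.1 hxy
    exact openGraph_adj.2 ⟨hne, e f, hf, hends⟩

variable [Fintype E] [DecidableEq E] [Fintype E'] [DecidableEq E']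

/-- Membership in `tgtU` is invariant under relabelling the edges. -/
lemma mem_tgtU_comp_equiv {l h o : V} (ζ : Config E) :
    ζ ∈ tgtU ends l h {S : Set V | o ∈ S} ↔ ζ ∘ e ∈ tgtU (ends ∘ e) l h {S : Set V | o ∈ S} := by
  simp only [tgtU, Finset.mem_filter, Finset.mem_univ, true_and, mem_hull_iff, Set.mem_setOf_eq]
  have e1 : blue (ζ ∘ e) = blue ζ ∘ e := rfl
  rw [cluster_comp_equiv ends e ζ l, cluster_comp_equiv ends e (blue ζ) l, e1]

/-- **Row (SW) is invariant under relabelling the edges.** -/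
theorem sw_of_equiv {l h o : V} (hs : Sw (ends ∘ e) l h o) : Sw ends l h o := by
  obtain ⟨f, hf, hmem⟩ := hs
  have hc : ∀ g : Config E, (g ∘ e) ∘ e.symm = g := fun g => by
    funext x; simp [Function.comp]
  have hc' : ∀ g : Config E', (g ∘ e.symm) ∘ e = g := fun g => by
    funext x; simp [Function.comp]
  refine ⟨fun x => f ⟨x.1 ∘ e, (mem_tgtU_comp_equiv ends e x.1).1 x.2⟩ ∘ e.symm, ?_, ?_⟩
  · intro x y hxy
    have h1 : f ⟨x.1 ∘ e, (mem_tgtU_comp_equiv ends e x.1).1 x.2⟩ =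
        f ⟨y.1 ∘ e, (mem_tgtU_comp_equiv ends e y.1).1 y.2⟩ := by
      have this : (f ⟨x.1 ∘ e, (mem_tgtU_comp_equiv ends e x.1).1 x.2⟩ ∘ e.symm) ∘ e =
          (f ⟨y.1 ∘ e, (mem_tgtU_comp_equiv ends e y.1).1 y.2⟩ ∘ e.symm) ∘ e :=
        congrArg (fun ζ => ζ ∘ e) hxy
      rwa [hc', hc'] at this
    have h2 : x.1 ∘ e = y.1 ∘ e := congrArg Subtype.val (hf h1)
    apply Subtype.ext
    have this : (x.1 ∘ e) ∘ e.symm = (y.1 ∘ e) ∘ e.symm := congrArg (fun ζ => ζ ∘ e.symm) h2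
    rwa [hc, hc] at this
  · intro x
    obtain ⟨ht, hsub⟩ := hmem ⟨x.1 ∘ e, (mem_tgtU_comp_equiv ends e x.1).1 x.2⟩
    refine ⟨?_, ?_⟩
    · rw [mem_tgtU_comp_equiv ends e, hc']
      exact ht
    · have e2 : blue (f ⟨x.1 ∘ e, (mem_tgtU_comp_equiv ends e x.1).1 x.2⟩ ∘ e.symm) =
          blue (f ⟨x.1 ∘ e, (mem_tgtU_comp_equiv ends e x.1).1 x.2⟩) ∘ e.symm := rfl
      rw [cluster_comp_equiv ends e x.1 h, e2, cluster_comp_equiv ends e _ h, hc']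
      exact hsub

end Equiv

/-! ## Cut vertices and the decomposition into a gluing -/

section Cut

variable {E : Type*} (ends : E → Sym2 V)

/-- `c` is a cut vertex of `ends` with sides `V₁`, `V₂`: the sides cover `V` and meet exactly in `c`,
every edge lies inside a side, and each side carries an edge not inside the other. -/
structure HasCut (c : V) (V₁ V₂ : Set V) : Prop where
  /-- `c` lies on the first side. -/
  c_mem₁ : c ∈ V₁
  /-- `c` lies on the second side. -/
  c_mem₂ : c ∈ V₂
  /-- The sides meet only in `c`. -/
  inter : ∀ x, x ∈ V₁ → x ∈ V₂ → x = c
  /-- The sides cover the vertices. -/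
  cover : ∀ x, x ∈ V₁ ∨ x ∈ V₂
  /-- Every edge lies inside a side. -/
  side : ∀ e, (∀ x ∈ ends e, x ∈ V₁) ∨ (∀ x ∈ ends e, x ∈ V₂)
  /-- The first side carries an edge not inside the second. -/
  edge₁ : ∃ e, ¬ ∀ x ∈ ends e, x ∈ V₂
  /-- The second side carries an edge not inside the first. -/
  edge₂ : ∃ e, ¬ ∀ x ∈ ends e, x ∈ V₁

/-- The first side of a cut: the edges inside `V₁`. -/
abbrev sideE₁ (V₁ : Set V) : Type _ := {e : E // ∀ x ∈ ends e, x ∈ V₁}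

/-- The second side of a cut: the edges not inside `V₁`. -/
abbrev sideE₂ (V₁ : Set V) : Type _ := {e : E // ¬ ∀ x ∈ ends e, x ∈ V₁}

/-- The incidence map of the first side. -/
def ends₁ (V₁ : Set V) : sideE₁ ends V₁ → Sym2 V := fun e => ends e.1

/-- The incidence map of the second side. -/
def ends₂ (V₁ : Set V) : sideE₂ ends V₁ → Sym2 V := fun e => ends e.1

/-- A cut vertex gives a gluing. -/
lemma HasCut.isGluing {c : V} {V₁ V₂ : Set V} (hc : HasCut ends c V₁ V₂) :
    IsGluing (ends₁ ends V₁) (ends₂ ends V₁) c V₁ V₂ := by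
  refine ⟨hc.c_mem₁, hc.c_mem₂, hc.inter, fun e x hx => e.2 x hx, fun e x hx => ?_⟩
  rcases hc.side e.1 with h | h
  · exact absurd h e.2
  · exact h x hx

/-- The glued graph of the two sides is the original graph, relabelled by `Equiv.sumCompl`. -/
lemma glue_sides_eq (V₁ : Set V) :
    glue (ends₁ ends V₁) (ends₂ ends V₁) = ends ∘ (Equiv.sumCompl fun e => ∀ x ∈ ends e, x ∈ V₁) := by
  funext e
  rcases e with e | e <;> rfl

end Cut

/-! ## The block reduction -/

/-- Row (SW) on every multigraph without a cut vertex. -/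
def SwNoCut : Prop :=
  ∀ (V E : Type) [Fintype V] [DecidableEq V] [Fintype E] [DecidableEq E] (ends : E → Sym2 V),
    (¬ ∃ (c : V) (V₁ V₂ : Set V), HasCut ends c V₁ V₂) →
      ∀ l h o : V, l ≠ h → o ≠ l → o ≠ h → Sw ends l h o

/-- **The block reduction**: row (SW) on the multigraphs without a cut vertex gives row (SW) on
every finite multigraph. -/
theorem sw_all_of_noCut (hbase : SwNoCut) : Sw_all := by
  -- strong induction on the number of edges
  suffices key : ∀ n : ℕ, ∀ (V E : Type) [Fintype V] [DecidableEq V] [Fintype E] [DecidableEq E]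
      (ends : E → Sym2 V), Fintype.card E = n →
        ∀ l h o : V, l ≠ h → o ≠ l → o ≠ h → Sw ends l h o by
    intro V E _ _ _ _ ends l h o hlh hol hoh
    exact key _ V E ends rfl l h o hlh hol hoh
  intro n
  induction n using Nat.strong_induction_on with
  | _ n ih =>
    intro V E _ _ _ _ ends hn l h o hlh hol hoh
    by_cases hcut : ∃ (c : V) (V₁ V₂ : Set V), HasCut ends c V₁ V₂
    · obtain ⟨c, V₁, V₂, hc⟩ := hcut
      -- the two sides have fewer edges
      have h₁ : Fintype.card (sideE₁ ends V₁) < n := by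
        rw [← hn]
        obtain ⟨e, he⟩ := hc.edge₂
        exact Fintype.card_subtype_lt (x := e) he
      have h₂ : Fintype.card (sideE₂ ends V₁) < n := by
        rw [← hn]
        obtain ⟨e, he⟩ := hc.edge₁
        have he' : ∀ x ∈ ends e, x ∈ V₁ := by
          rcases hc.side e with h | h
          · exact h
          · exact absurd h he
        exact Fintype.card_subtype_lt (x := e) (not_not.2 he')
      have hs₁ : ∀ l h o : V, l ≠ h → o ≠ l → o ≠ h → Sw (ends₁ ends V₁) l h o :=
        ih _ h₁ V (sideE₁ ends V₁) (ends₁ ends V₁) rfl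
      have hs₂ : ∀ l h o : V, l ≠ h → o ≠ l → o ≠ h → Sw (ends₂ ends V₁) l h o :=
        ih _ h₂ V (sideE₂ ends V₁) (ends₂ ends V₁) rfl
      have hglue := sw_glue_of_sides hc.isGluing hs₁ hs₂ hlh hol hoh (hc.cover l) (hc.cover h)
        (hc.cover o)
      rw [glue_sides_eq] at hglue
      exact sw_of_equiv ends _ hglue
    · exact hbase V E ends hcut l h o hlh hol hoh

end Glue

end Summit.Ventures.PercRepro2
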